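import Mathlib.MeasureTheory.Function.LpSpace.Complete
import Mathlib.MeasureTheory.Integral.Lebesgue.Add
import Mathlib.MeasureTheory.Integral.Lebesgue.Markov
import Literature.Analysis.FunctionSpaces.BesovSliceMeasurability
import Literature.Analysis.FunctionSpaces.TimeMollification
import HarnessLib

/-!
# Lower semicontinuity of the Nikol'skii–Besov norms under a.e. convergence (Fatou)

Analysis/FunctionSpaces support file (theorem-only; serves the vanishing-viscosity
intermittency barrier `Literature/Barriers/AnomalousDissipation/IntermittentDissipation`,
whose printed proof — De Rosa–Isett, ARMA 248 (2024), §6.1 — passes a uniform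
`L^p_t B^θ_{p,∞}` bound to a strong `L^p_{x,t}` limit: "`v^ν → v` in `L^p_{x,t}` and moreover
`v ∈ L^p_t(B^θ_{p,∞})`").

For the difference-quotient classes of `Literature.Analysis.FunctionSpaces.BesovDifference` on
the flat torus `T^d`:

* `Torus.eBesovSupNorm_le_liminf_of_tendsto_ae` — **Fatou for `B^θ_{q,∞}(T^d)`**: if
  a.e.-strongly measurable `f_n → g` a.e., then `‖g‖_{B^θ_{q,∞}} ≤ liminf ‖f_n‖_{B^θ_{q,∞}}`
  (each translate difference `f_n(· + h) - f_n` converges a.e., translation preserving the Haar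
  measure, so Mathlib's `Lp.eLpNorm_lim_le_liminf_eLpNorm` bounds every difference quotient;
  suprema over `h` and the sum with the `L^q` part pass under the `liminf`).
* `Torus.memLpBesovSup_of_tendsto_ae` — **the space–time form**: if jointly measurable fields
  `w_k` on `S × T^d` with slices in `B^θ_{q,∞}` for a.e. `t ∈ S` and
  `‖w_k‖_{L^q(S; B^θ_{q,∞})} ≤ M` (`1 ≤ q < ∞`) converge a.e. on `S × T^d` to the jointly
  measurable `v`, then `v(t) ∈ B^θ_{q,∞}` for a.e. `t ∈ S` and `‖v‖_{L^q(S; B^θ_{q,∞})} ≤ M`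
  (the slice inequality for a.e. `t`, then Fatou in time, `lintegral_liminf_le'`, the slice norms
  being a.e.-measurable in time by `Torus.aemeasurable_eBesovSupSeminorm_slice` and the tree's
  `aemeasurable_eLpNorm_slice` of `TimeMollification`; the bound also makes the limit's slice
  norms a.e. finite, killing the `toReal` junk of `eLpBesovSupNorm`).
* Glue (proved): `Torus.eLpBesovSupNorm_eq_lintegral` (the `L^q_t B` norm as a lower
  integral of the slice norms when these are a.e. finite); superadditivity of `liminf` on
  `ℝ≥0∞` is inlined (the tree's `Literature.Analysis.FluidPDE.liminf_add_liminf_le_liminf_add`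
  lives in a Navier–Stokes file that a function-space support file should not import).

Finite exponents `q < ∞` only (the `L^∞`-Besov slice seminorms are not known to be measurable
in time here). Strong `L^r_{t,x}` convergence enters only through an a.e.-convergent
subsequence, which consumers extract themselves.

## Mathlib search

Mathlib (this pin) has Fatou for `eLpNorm` under a.e. convergence
(`MeasureTheory.Lp.eLpNorm_lim_le_liminf_eLpNorm`), `lintegral_liminf_le'`,
`Measurable.liminf`, `ENNReal.liminf_mul_const_of_ne_top`, `ENNReal.iSup_add_iSup_of_monotone`;
it has no Besov classes and no `liminf` superadditivity on `ℝ≥0∞` (searched `Besov`,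
`liminf_add`: only the `AddCommGroup` version `le_liminf_add` of
`Topology/Algebra/Order/LiminfLimsup`; the tree has the `ℝ≥0∞` sequence version in
`Literature.Analysis.FluidPDE.KochTataruFixedPoint`).

## References

* L. De Rosa, P. Isett, Arch. Ration. Mech. Anal. 248 (2024), §6.1 (the use). [DeRosaIsett2024]
* H. Triebel, *Theory of Function Spaces* (1983), §2.5.12 (the difference norms; Fatou property
  of Besov quasi-norms). [folklore]
-/

open MeasureTheory Set Filter Function
open _root_.Topology
open scoped ENNReal NNReal

noncomputable section

namespace Literature.Analysis.FunctionSpaces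

namespace Torus

variable {d : Type*} [Fintype d] {E : Type*} [NormedAddCommGroup E]

/-! ## Fatou for the Besov norm on a slice -/

/-- **Fatou for `B^θ_{q,∞}(T^d)`.** If a.e.-strongly measurable `f_n : T^d → E` converge a.e. to
`g`, then `‖g‖_{B^θ_{q,∞}} ≤ liminf_n ‖f_n‖_{B^θ_{q,∞}}` (difference norms of
`Literature.Analysis.FunctionSpaces.BesovDifference`, any `θ`, any `q`): every difference
quotient is lower semicontinuous (translation by `h` preserves `volume`, so
`f_n(· + h) - f_n → g(· + h) - g` a.e., and Mathlib's `Lp.eLpNorm_lim_le_liminf_eLpNorm`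
applies), the supremum over `h ≠ 0` of `liminf`s is at most the `liminf` of the suprema, and
`liminf` is superadditive on `ℝ≥0∞`. [folklore] -/
theorem eBesovSupNorm_le_liminf_of_tendsto_ae {f : ℕ → UnitAddTorus d → E}
    {g : UnitAddTorus d → E} (hf : ∀ n, AEStronglyMeasurable (f n) volume)
    (hlim : ∀ᵐ x ∂volume, Tendsto (fun n => f n x) atTop (𝓝 (g x))) (θ : ℝ) (q : ℝ≥0∞) :
    eBesovSupNorm θ q g volume ≤ liminf (fun n => eBesovSupNorm θ q (f n) volume) atTop := by
  have h0 : eLpNorm g q volume ≤ liminf (fun n => eLpNorm (f n) q volume) atTop :=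
    MeasureTheory.Lp.eLpNorm_lim_le_liminf_eLpNorm (p := q) hf g hlim
  have h1 : ∀ h : UnitAddTorus d, h ≠ 0 → eDiffQuotient θ q g volume h ≤
      liminf (fun n => eDiffQuotient θ q (f n) volume h) atTop := by
    intro h hh
    have hmp := measurePreserving_add_right (volume : Measure (UnitAddTorus d)) h
    have hf' : ∀ n, AEStronglyMeasurable (fun x => f n (x + h) - f n x) volume := fun n =>
      ((hf n).comp_measurePreserving hmp).sub (hf n)
    have hlim' : ∀ᵐ x ∂volume, Tendsto (fun n => f n (x + h) - f n x) atTop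
        (𝓝 (g (x + h) - g x)) := by
      filter_upwards [hlim, hmp.quasiMeasurePreserving.ae hlim] with x hx hxh
      exact hxh.sub hx
    have hF := MeasureTheory.Lp.eLpNorm_lim_le_liminf_eLpNorm (p := q) hf'
      (fun x => g (x + h) - g x) hlim'
    have hc0 : ENNReal.ofReal (‖h‖ ^ θ) ≠ 0 := (ofReal_norm_rpow_pos θ hh).ne'
    unfold eDiffQuotient
    calc eLpNorm (fun x => g (x + h) - g x) q volume / ENNReal.ofReal (‖h‖ ^ θ)
        = eLpNorm (fun x => g (x + h) - g x) q volume * (ENNReal.ofReal (‖h‖ ^ θ))⁻¹ := rfl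
      _ ≤ liminf (fun n => eLpNorm (fun x => f n (x + h) - f n x) q volume) atTop *
            (ENNReal.ofReal (‖h‖ ^ θ))⁻¹ := mul_le_mul' hF le_rfl
      _ = liminf (fun n => eLpNorm (fun x => f n (x + h) - f n x) q volume *
            (ENNReal.ofReal (‖h‖ ^ θ))⁻¹) atTop := by
          rw [ENNReal.liminf_mul_const_of_ne_top (ENNReal.inv_ne_top.2 hc0), mul_comm]
      _ = _ := rfl
  have h2 : eBesovSupSeminorm θ q g volume ≤
      liminf (fun n => eBesovSupSeminorm θ q (f n) volume) atTop := by
    unfold eBesovSupSeminorm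
    refine iSup₂_le fun h hh => (h1 h hh).trans (liminf_le_liminf (Eventually.of_forall fun n => ?_))
    exact le_iSup₂ (f := fun (h : UnitAddTorus d) (_ : h ≠ 0) => eDiffQuotient θ q (f n) volume h) h hh
  -- superadditivity of `liminf` on `ℝ≥0∞` (the tree has it as
  -- `Literature.Analysis.FluidPDE.liminf_add_liminf_le_liminf_add`, in a file this support file
  -- must not import; five lines, inlined)
  have hadd : ∀ a b : ℕ → ℝ≥0∞,
      liminf a atTop + liminf b atTop ≤ liminf (fun n => a n + b n) atTop := by
    intro a b
    simp only [liminf_eq_iSup_iInf_of_nat]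
    rw [ENNReal.iSup_add_iSup_of_monotone
      (fun n m hnm => le_iInf₂ fun i hi => iInf₂_le i (hnm.trans hi))
      (fun n m hnm => le_iInf₂ fun i hi => iInf₂_le i (hnm.trans hi))]
    exact iSup_mono fun n => le_iInf₂ fun i hi => add_le_add (iInf₂_le i hi) (iInf₂_le i hi)
  unfold eBesovSupNorm
  exact (add_le_add h0 h2).trans (hadd _ _)

/-! ## Measurability and finiteness in time -/

/-- The `L^q_t B^θ_{q,∞}` norm (`0 < q < ∞`) as a lower integral of the slice norms,
`‖u‖_{L^q(S;B)} = (∫⁻_S ‖u(t)‖_B^q)^{1/q}`, when these are a.e. finite (so that the real-valued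
time integrand `(‖u(t)‖_B).toReal` of `eLpBesovSupNorm` carries no junk). [folklore] -/
theorem eLpBesovSupNorm_eq_lintegral {S : Set ℝ} {u : ℝ → UnitAddTorus d → E} {q : ℝ≥0∞}
    (hq0 : q ≠ 0) (hq' : q ≠ ∞) {θ : ℝ}
    (hfin : ∀ᵐ t ∂(volume.restrict S), eBesovSupNorm θ q (u t) volume < ∞) :
    eLpBesovSupNorm q θ q u volume S =
      (∫⁻ t, eBesovSupNorm θ q (u t) volume ^ q.toReal ∂(volume.restrict S)) ^ (1 / q.toReal) := by
  unfold eLpBesovSupNorm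
  rw [eLpNorm_congr_enorm_ae (g := fun t => eBesovSupNorm θ q (u t) volume) ?_,
    eLpNorm_eq_lintegral_rpow_enorm_toReal hq0 hq']
  · simp only [enorm_eq_self]
  · filter_upwards [hfin] with t ht
    rw [Real.enorm_of_nonneg ENNReal.toReal_nonneg, ENNReal.ofReal_toReal ht.ne, enorm_eq_self]

/-! ## The space–time form -/

/-- **Lower semicontinuity of the `L^q_t B^θ_{q,∞}` norm under a.e. convergence on
`S × T^d`** (folklore Fatou; the passage "`v^ν → v` … and moreover `v ∈ L^p_t(B^θ_{p,∞})`" of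
De Rosa–Isett 2024, §6.1, once an a.e.-convergent subsequence has been extracted from the
strong limit). Let `1 ≤ q < ∞`, let `w_k, v : ℝ → T^d → E` be jointly (a.e.-strongly)
measurable on `S × T^d`, with `w_k(t) ∈ B^θ_{q,∞}(T^d)` for a.e. `t ∈ S` and
`‖w_k‖_{L^q(S; B^θ_{q,∞})} ≤ M` for all `k`, and suppose `w_k → v` a.e. on `S × T^d`. Then
`v(t) ∈ B^θ_{q,∞}` for a.e. `t ∈ S`, `‖v‖_{L^q(S; B^θ_{q,∞})} ≤ M`, in particular
`v ∈ L^q(S; B^θ_{q,∞})` (`MemLpBesovSup`). Proof: a.e. slice converges a.e. (Tonelli), so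
`eBesovSupNorm_le_liminf_of_tendsto_ae` bounds `‖v(t)‖_B` by `liminf_k ‖w_k(t)‖_B` for a.e. `t`;
raising to the power `q` (monotone and continuous) and integrating, Fatou in time
(`lintegral_liminf_le'`; the slice norms of the `w_k` are a.e.-measurable in time and a.e.
finite, so `∫⁻ ‖w_k(t)‖_B^q = ‖w_k‖^q_{L^q_tB} ≤ M^q`) gives `∫⁻ ‖v(t)‖_B^q ≤ M^q`; this first
makes `‖v(t)‖_{L^q}` a.e. finite (so the seminorm slice of `v` is a.e.-measurable in time), then
`‖v(t)‖_B` a.e. finite, and the bound follows by `eLpBesovSupNorm_eq_lintegral`. [folklore] -/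
theorem memLpBesovSup_of_tendsto_ae {S : Set ℝ} {w : ℕ → ℝ → UnitAddTorus d → E}
    {v : ℝ → UnitAddTorus d → E} {q : ℝ≥0∞} (hq : 1 ≤ q) (hq' : q ≠ ∞) {θ : ℝ} {M : ℝ≥0}
    (hw : ∀ k, AEStronglyMeasurable (uncurry (w k)) ((volume.restrict S).prod volume))
    (hwB : ∀ k, MemLpBesovSup q θ q (w k) volume S)
    (hwM : ∀ k, eLpBesovSupNorm q θ q (w k) volume S ≤ M)
    (hv : AEStronglyMeasurable (uncurry v) ((volume.restrict S).prod volume))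
    (hae : ∀ᵐ z ∂((volume.restrict S).prod volume),
      Tendsto (fun k => w k z.1 z.2) atTop (𝓝 (v z.1 z.2))) :
    MemLpBesovSup q θ q v volume S ∧ eLpBesovSupNorm q θ q v volume S ≤ M := by
  have hq0 : q ≠ 0 := (zero_lt_one.trans_le hq).ne'
  have hqr : 0 < q.toReal := ENNReal.toReal_pos hq0 hq'
  -- a.e. slice converges a.e.; slices are a.e.-strongly measurable
  have hslice : ∀ᵐ t ∂(volume.restrict S), ∀ᵐ x ∂(volume : Measure (UnitAddTorus d)),
      Tendsto (fun k => w k t x) atTop (𝓝 (v t x)) :=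
    Measure.ae_ae_of_ae_prod hae
  have hwslice : ∀ᵐ t ∂(volume.restrict S), ∀ k, AEStronglyMeasurable (w k t) volume := by
    rw [ae_all_iff]
    exact fun k => (hw k).prodMk_left
  have hvslice : ∀ᵐ t ∂(volume.restrict S), AEStronglyMeasurable (v t) volume := hv.prodMk_left
  -- slice-wise lower semicontinuity
  set N : ℕ → ℝ → ℝ≥0∞ := fun k t => eBesovSupNorm θ q (w k t) volume with hN
  set Nv : ℝ → ℝ≥0∞ := fun t => eBesovSupNorm θ q (v t) volume with hNv
  have hlsc : ∀ᵐ t ∂(volume.restrict S), Nv t ≤ liminf (fun k => N k t) atTop := by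
    filter_upwards [hslice, hwslice] with t ht hmt
    exact eBesovSupNorm_le_liminf_of_tendsto_ae hmt ht θ q
  -- the slice norms of the `w_k`: a.e. finite, a.e.-measurable, `∫ N_k^q ≤ M^q`
  have hNfin : ∀ k, ∀ᵐ t ∂(volume.restrict S), N k t < ∞ := fun k => by
    filter_upwards [(hwB k).1] with t ht
    exact ENNReal.add_lt_top.2 ⟨ht.1.eLpNorm_lt_top, ht.2⟩
  have hNmeas : ∀ k, AEMeasurable (N k) (volume.restrict S) := fun k => by
    have hLp : ∀ᵐ t ∂(volume.restrict S), MemLp (w k t) q volume := (hwB k).1.mono fun t ht => ht.1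
    exact (FunctionSpaces.aemeasurable_eLpNorm_slice (hw k) q).add
      (Torus.aemeasurable_eBesovSupSeminorm_slice hq hq' (hw k) hLp)
  have hNint : ∀ k, ∫⁻ t, N k t ^ q.toReal ∂(volume.restrict S) ≤ (M : ℝ≥0∞) ^ q.toReal := by
    intro k
    have h1 := hwM k
    rw [eLpBesovSupNorm_eq_lintegral hq0 hq' (hNfin k)] at h1
    have h2 := ENNReal.rpow_le_rpow h1 hqr.le
    rwa [one_div, ENNReal.rpow_inv_rpow hqr.ne'] at h2
  -- Fatou in time
  have hFatou : ∫⁻ t, liminf (fun k => N k t ^ q.toReal) atTop ∂(volume.restrict S) ≤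
      (M : ℝ≥0∞) ^ q.toReal :=
    (lintegral_liminf_le' fun k => (hNmeas k).pow_const _).trans
      (liminf_le_of_frequently_le' (Frequently.of_forall hNint))
  have hpow : ∀ᵐ t ∂(volume.restrict S),
      Nv t ^ q.toReal ≤ liminf (fun k => N k t ^ q.toReal) atTop := by
    filter_upwards [hlsc] with t ht
    calc Nv t ^ q.toReal ≤ (liminf (fun k => N k t) atTop) ^ q.toReal :=
          ENNReal.rpow_le_rpow ht hqr.le
      _ = liminf (fun k => N k t ^ q.toReal) atTop :=
          (ENNReal.monotone_rpow_of_nonneg hqr.le).map_liminf_of_continuousAt (fun k => N k t)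
            ENNReal.continuous_rpow_const.continuousAt
  have hint_v : ∫⁻ t, Nv t ^ q.toReal ∂(volume.restrict S) ≤ (M : ℝ≥0∞) ^ q.toReal :=
    (lintegral_mono_ae hpow).trans hFatou
  have hMq : (M : ℝ≥0∞) ^ q.toReal ≠ ∞ := ENNReal.rpow_ne_top_of_nonneg hqr.le ENNReal.coe_ne_top
  -- the `L^q` parts of the limit slices are a.e. finite, hence the slices are in `L^q`
  have hvq : AEMeasurable (fun t => eLpNorm (v t) q volume) (volume.restrict S) :=
    FunctionSpaces.aemeasurable_eLpNorm_slice hv q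
  have hvLp : ∀ᵐ t ∂(volume.restrict S), MemLp (v t) q volume := by
    have hle : ∫⁻ t, eLpNorm (v t) q volume ^ q.toReal ∂(volume.restrict S) ≤
        (M : ℝ≥0∞) ^ q.toReal :=
      (lintegral_mono fun t => ENNReal.rpow_le_rpow
        (le_self_add : eLpNorm (v t) q volume ≤ Nv t) hqr.le).trans hint_v
    filter_upwards [hvslice, ae_lt_top' (hvq.pow_const _) (ne_top_of_le_ne_top hMq hle)]
      with t h1 h2
    exact ⟨h1, (ENNReal.rpow_lt_top_iff_of_pos hqr).1 h2⟩
  -- so the full slice norms of the limit are a.e.-measurable and a.e. finite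
  have hNv_meas : AEMeasurable Nv (volume.restrict S) :=
    hvq.add (Torus.aemeasurable_eBesovSupSeminorm_slice hq hq' hv hvLp)
  have hNv_fin : ∀ᵐ t ∂(volume.restrict S), Nv t < ∞ := by
    filter_upwards [ae_lt_top' (hNv_meas.pow_const _) (ne_top_of_le_ne_top hMq hint_v)] with t ht
    exact (ENNReal.rpow_lt_top_iff_of_pos hqr).1 ht
  have hbound : eLpBesovSupNorm q θ q v volume S ≤ M := by
    rw [eLpBesovSupNorm_eq_lintegral hq0 hq' hNv_fin]
    calc (∫⁻ t, Nv t ^ q.toReal ∂(volume.restrict S)) ^ (1 / q.toReal)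
        ≤ ((M : ℝ≥0∞) ^ q.toReal) ^ (1 / q.toReal) := ENNReal.rpow_le_rpow hint_v (by positivity)
      _ = M := by rw [one_div, ENNReal.rpow_rpow_inv hqr.ne']
  refine ⟨⟨?_, hbound.trans_lt ENNReal.coe_lt_top⟩, hbound⟩
  filter_upwards [hvLp, hNv_fin] with t h1 h2
  exact ⟨h1, lt_of_le_of_lt le_add_self h2⟩

end Torus

end Literature.Analysis.FunctionSpaces

end
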